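import Literature.Analysis.FunctionSpaces.SobolevTracePoincareProofs
import Literature.Analysis.FluidPDE.EnergyToolkit
import HarnessLib

/-!
# Poincaré inequalities on star-shaped pieces, real-valued square form

Analysis/FluidPDE support file for the discharge of the named fact
`Literature.Analysis.FluidPDE.tao2011_nonlinearEstimate` (Tao 2011, §10, proof of Thm. 10.1,
estimate of `Y₆`, arXiv:1108.1165 pp. 32–33). The chaining step of the printed proof uses the
Poincaré inequality on overlapping Whitney balls ("From this inequality, we see in particular that
`|(|3Bᵢ|⁻¹∫_{3Bᵢ}|ω|²)^{1/2} − (|3Bⱼ|⁻¹∫_{3Bⱼ}|ω|²)^{1/2}| ≲ (rᵢ⁻¹∫_{10Bᵢ}|∇ω|²)^{1/2}` whenever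
`Bᵢ, Bⱼ` intersect", p. 33). The tree proves the scale-correct two-point estimate for `C¹` maps on
domains star-shaped with respect to a set (`Literature.Analysis.FunctionSpaces.eLpNorm_prod_sub_le_of_contDiff`,
Maz'ya §1.1.10) and the averaging step
(`Literature.Analysis.FunctionSpaces.eLpNorm_sub_setAverage_le_of_prod`), in `ℝ≥0∞`/`eLpNorm`
form. This file extracts the two real-valued `L²` consequences used by the chain:

* `setIntegral_sq_norm_sub_setAverage_le` — for `f ∈ C¹`, an open bounded `A`, a measurable
  `B ⊆ A` of positive measure such that `A` is star-shaped with respect to every point of `B`, and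
  `‖y - x‖ ≤ δ` on `A × B`:
  `∫_A ‖f − ⨍_B f‖² ≤ 2ⁿ δ² (μ(A)/μ(B)) ∫_A ‖Df‖²` (`n = dim E`);
* `sq_norm_setAverage_sub_setAverage_le` — for a further measurable `S ⊆ A` of positive measure,
  `‖⨍_S f − ⨍_B f‖² ≤ μ(S)⁻¹ 2ⁿ δ² (μ(A)/μ(B)) ∫_A ‖Df‖²` (Jensen).

## References

* V. G. Maz'ja, *Sobolev Spaces* (1985), §1.1.10–1.1.11 (`Mazja1985`).
* T. Tao, arXiv:1108.1165 (`Tao2011`), §10, proof of Thm. 10.1, p. 33 (the Poincaré step).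
-/

noncomputable section

open MeasureTheory Set Filter Metric Function
open scoped ENNReal NNReal

namespace Literature.Analysis.FluidPDE.TaoY6

section Poincare

variable {E : Type*} [NormedAddCommGroup E] [NormedSpace ℝ E] [FiniteDimensional ℝ E]
  [MeasurableSpace E] [BorelSpace E] {μ : Measure E} [μ.IsAddHaarMeasure]
variable {F : Type*} [NormedAddCommGroup F] [NormedSpace ℝ F] [CompleteSpace F]

omit [NormedSpace ℝ F] [CompleteSpace F] in
/-- `‖g‖_{L²(ν)}² = ∫⁻ ‖g‖ₑ²`. [folklore] -/
theorem eLpNorm_two_pow_two_eq_lintegral {α : Type*} [MeasurableSpace α] (ν : Measure α)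
    (g : α → F) :
    eLpNorm g 2 ν ^ 2 = ∫⁻ x, ‖g x‖ₑ ^ 2 ∂ν := by
  rw [eLpNorm_eq_lintegral_rpow_enorm_toReal two_ne_zero ENNReal.ofNat_ne_top, ENNReal.toReal_ofNat,
    ← ENNReal.rpow_natCast, ← ENNReal.rpow_mul]
  norm_num

omit [NormedSpace ℝ F] [CompleteSpace F] in
/-- `∫⁻ ‖g‖ₑ² = ofReal (∫ ‖g‖²)` for `‖g‖²` integrable. [folklore] -/
theorem lintegral_enorm_sq_eq_ofReal_integral_sq {α : Type*} [MeasurableSpace α] (ν : Measure α) {g : α → F}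
    (hg : Integrable (fun x => ‖g x‖ ^ 2) ν) :
    ∫⁻ x, ‖g x‖ₑ ^ 2 ∂ν = ENNReal.ofReal (∫ x, ‖g x‖ ^ 2 ∂ν) := by
  rw [ofReal_integral_eq_lintegral_ofReal hg (Eventually.of_forall fun x => sq_nonneg _)]
  refine lintegral_congr fun x => ?_
  rw [← ofReal_norm, ← ENNReal.ofReal_pow (norm_nonneg _)]

omit [MeasurableSpace E] [BorelSpace E] in
/-- A continuous function is integrable on a bounded measurable set (finite-dimensional space,
locally finite measure). [folklore] -/
theorem integrableOn_of_continuous_of_isBounded [MeasurableSpace E] [BorelSpace E]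
    {ν : Measure E} [IsLocallyFiniteMeasure ν] {G : Type*} [NormedAddCommGroup G] {g : E → G}
    (hg : Continuous g) {A : Set E} (hAb : Bornology.IsBounded A) :
    IntegrableOn g A ν :=
  (hg.continuousOn.integrableOn_compact hAb.isCompact_closure).mono_set subset_closure

/-- **Poincaré inequality on a piece star-shaped with respect to a subset, square form.** For
`f ∈ C¹(E; F)`, an open bounded `A`, a measurable `B ⊆ A` with `μ B ≠ 0` such that every segment
from a point of `A` to a point of `B` lies in `A`, and `‖y − x‖ ≤ δ` for `x ∈ A`, `y ∈ B`:
`∫_A ‖f − ⨍_B f‖² ≤ 2ⁿ δ² (μ(A)/μ(B)) ∫_A ‖Df‖²`, `n = dim E` (Maz'ya §1.1.11; the two-point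
estimate of the tree squared and averaged over `B`). [cite: Mazja1985, §1.1.11 Lemma] -/
theorem setIntegral_sq_norm_sub_setAverage_le {f : E → F} (hf : ContDiff ℝ 1 f) {A B : Set E}
    (hA : IsOpen A) (hAb : Bornology.IsBounded A) (hB : MeasurableSet B) (hBA : B ⊆ A)
    (hseg : ∀ x ∈ A, ∀ y ∈ B, segment ℝ x y ⊆ A) {δ : ℝ} (hδ0 : 0 < δ)
    (hδ : ∀ x ∈ A, ∀ y ∈ B, ‖y - x‖ ≤ δ) (hB0 : μ B ≠ 0) :
    ∫ x in A, ‖f x - ⨍ y in B, f y ∂μ‖ ^ 2 ∂μ ≤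
      2 ^ Module.finrank ℝ E * δ ^ 2 * (μ.real A / μ.real B) *
        ∫ x in A, ‖fderiv ℝ f x‖ ^ 2 ∂μ := by
  have hAt : μ A ≠ ∞ := hAb.measure_lt_top.ne
  have hBt : μ B ≠ ∞ := measure_ne_top_of_subset hBA hAt
  have hBb : Bornology.IsBounded B := hAb.subset hBA
  haveI : IsFiniteMeasure (μ.restrict A) := isFiniteMeasure_restrict.2 hAt
  set c : F := ⨍ y in B, f y ∂μ with hc
  -- integrability facts
  have hfc : Continuous f := hf.continuous
  have hDfc : Continuous (fderiv ℝ f) := hf.continuous_fderiv one_ne_zero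
  have hfB : IntegrableOn f B μ := integrableOn_of_continuous_of_isBounded hfc hBb
  have hfA : AEStronglyMeasurable f (μ.restrict A) := hfc.aestronglyMeasurable
  have hsubc : Continuous fun x => f x - c := hfc.sub continuous_const
  have hI1 : IntegrableOn (fun x => ‖f x - c‖ ^ 2) A μ :=
    integrableOn_of_continuous_of_isBounded (hsubc.norm.pow 2) hAb
  have hI2 : IntegrableOn (fun x => ‖fderiv ℝ f x‖ ^ 2) A μ :=
    integrableOn_of_continuous_of_isBounded (hDfc.norm.pow 2) hAb
  -- the two tree estimates, combined
  have h2pt := FunctionSpaces.eLpNorm_prod_sub_le_of_contDiff (μ := μ) hf hA hB hBA hseg hδ0 hδ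
    (p := 2) one_le_two
  have havg := FunctionSpaces.eLpNorm_sub_setAverage_le_of_prod (μ := μ) (S := A) hB0 hBt hfB hfA
    (p := 2) one_le_two
  have hcomb : eLpNorm (fun x => f x - c) 2 (μ.restrict A) ≤
      (μ B)⁻¹ ^ (1 / (2 : ℝ)) * (ENNReal.ofReal δ * 2 ^ ((Module.finrank ℝ E : ℝ) / 2) *
        μ A ^ (1 / (2 : ℝ)) * eLpNorm (fderiv ℝ f) 2 (μ.restrict A)) := by
    have h : eLpNorm (fun x => f x - c) 2 (μ.restrict A) ≤ (μ B)⁻¹ ^ (1 / (2 : ℝ≥0∞).toReal) *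
        (ENNReal.ofReal δ * 2 ^ ((Module.finrank ℝ E : ℝ) / (2 : ℝ≥0∞).toReal) *
          μ A ^ (1 / (2 : ℝ≥0∞).toReal) * eLpNorm (fderiv ℝ f) 2 (μ.restrict A)) :=
      havg.trans (by gcongr)
    simpa only [ENNReal.toReal_ofNat] using h
  -- square both sides
  have hsq := pow_le_pow_left' hcomb 2
  rw [eLpNorm_two_pow_two_eq_lintegral, lintegral_enorm_sq_eq_ofReal_integral_sq _ hI1] at hsq
  have hR : ((μ B)⁻¹ ^ (1 / (2 : ℝ)) * (ENNReal.ofReal δ * 2 ^ ((Module.finrank ℝ E : ℝ) / 2) *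
        μ A ^ (1 / (2 : ℝ)) * eLpNorm (fderiv ℝ f) 2 (μ.restrict A))) ^ 2 =
      (μ B)⁻¹ * (ENNReal.ofReal (δ ^ 2) * 2 ^ Module.finrank ℝ E * μ A *
        ∫⁻ x in A, ‖fderiv ℝ f x‖ₑ ^ 2 ∂μ) := by
    have e1 : ((μ B)⁻¹ ^ (1 / (2 : ℝ))) ^ 2 = (μ B)⁻¹ := by
      rw [← ENNReal.rpow_natCast, ← ENNReal.rpow_mul]; norm_num
    have e2 : (μ A ^ (1 / (2 : ℝ))) ^ 2 = μ A := by
      rw [← ENNReal.rpow_natCast, ← ENNReal.rpow_mul]; norm_num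
    have e3 : ((2 : ℝ≥0∞) ^ ((Module.finrank ℝ E : ℝ) / 2)) ^ 2 = 2 ^ Module.finrank ℝ E := by
      rw [← ENNReal.rpow_natCast, ← ENNReal.rpow_mul,
        show (Module.finrank ℝ E : ℝ) / 2 * ((2 : ℕ) : ℝ) = (Module.finrank ℝ E : ℝ) by push_cast; ring,
        ENNReal.rpow_natCast]
    have e4 : (ENNReal.ofReal δ) ^ 2 = ENNReal.ofReal (δ ^ 2) := by
      rw [ENNReal.ofReal_pow hδ0.le]
    rw [mul_pow, mul_pow, mul_pow, mul_pow, e1, e2, e3, e4, eLpNorm_two_pow_two_eq_lintegral]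
  rw [hR, lintegral_enorm_sq_eq_ofReal_integral_sq _ hI2] at hsq
  -- pass to real numbers
  have hμA : μ A = ENNReal.ofReal (μ.real A) := (ENNReal.ofReal_toReal hAt).symm
  have hμB : (μ B)⁻¹ = ENNReal.ofReal ((μ.real B)⁻¹) := by
    rw [measureReal_def, ENNReal.ofReal_inv_of_pos (ENNReal.toReal_pos hB0 hBt),
      ENNReal.ofReal_toReal hBt]
  have hAr : 0 ≤ μ.real A := measureReal_nonneg
  have hBr : 0 < μ.real B := ENNReal.toReal_pos hB0 hBt
  have hint : 0 ≤ ∫ x in A, ‖fderiv ℝ f x‖ ^ 2 ∂μ := integral_nonneg fun _ => sq_nonneg _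
  rw [hμA, hμB, show (2 : ℝ≥0∞) ^ Module.finrank ℝ E = ENNReal.ofReal (2 ^ Module.finrank ℝ E) by
      rw [ENNReal.ofReal_pow zero_le_two, ENNReal.ofReal_ofNat],
    ← ENNReal.ofReal_mul (sq_nonneg _), ← ENNReal.ofReal_mul (by positivity),
    ← ENNReal.ofReal_mul (by positivity), ← ENNReal.ofReal_mul (by positivity),
    ENNReal.ofReal_le_ofReal_iff (by positivity)] at hsq
  calc ∫ x in A, ‖f x - c‖ ^ 2 ∂μ
      ≤ (μ.real B)⁻¹ * (δ ^ 2 * 2 ^ Module.finrank ℝ E * μ.real A *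
          ∫ x in A, ‖fderiv ℝ f x‖ ^ 2 ∂μ) := hsq
    _ = 2 ^ Module.finrank ℝ E * δ ^ 2 * (μ.real A / μ.real B) *
          ∫ x in A, ‖fderiv ℝ f x‖ ^ 2 ∂μ := by
        rw [div_eq_mul_inv]; ring

omit [CompleteSpace F] in
/-- **Jensen for the square of an average**: `‖⨍_S h‖² ≤ μ(S)⁻¹ ∫_S ‖h‖²` for `μ S < ∞` and
`‖h‖² ∈ L¹(S)` (Cauchy–Schwarz against the constant `1`). [folklore] -/
theorem sq_norm_setAverage_le_inv_mul_setIntegral {α : Type*} [MeasurableSpace α] {μ : Measure α}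
    {S : Set α} (hSt : μ S ≠ ∞) {h : α → F}
    (hm : AEStronglyMeasurable h (μ.restrict S)) (hh : IntegrableOn (fun x => ‖h x‖ ^ 2) S μ) :
    ‖⨍ x in S, h x ∂μ‖ ^ 2 ≤ (μ.real S)⁻¹ * ∫ x in S, ‖h x‖ ^ 2 ∂μ := by
  haveI : IsFiniteMeasure (μ.restrict S) := isFiniteMeasure_restrict.2 hSt
  have hI0 : 0 ≤ ∫ x in S, ‖h x‖ ^ 2 ∂μ := integral_nonneg fun _ => sq_nonneg _
  rcases eq_or_ne (μ S) 0 with hS0 | hS0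
  · have h0 : μ.restrict S = 0 := Measure.restrict_eq_zero.2 hS0
    simp [h0]
  have hreal : 0 < μ.real S := ENNReal.toReal_pos hS0 hSt
  -- Cauchy–Schwarz: `∫_S ‖h‖ · 1 ≤ √(∫_S ‖h‖²) √(∫_S 1)`
  have hm2 : MemLp h 2 (μ.restrict S) := (memLp_two_iff_integrable_sq_norm hm).2 hh
  have h1 : MemLp (fun _ : α => (1 : ℝ)) 2 (μ.restrict S) := memLp_const 1
  have hCS := integral_norm_mul_norm_le_sqrt_mul_sqrt hm2 h1
  simp only [norm_one, mul_one, one_pow] at hCS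
  rw [integral_const, smul_eq_mul, mul_one, Measure.real, Measure.restrict_apply_univ] at hCS
  have hn1 : ‖∫ x in S, h x ∂μ‖ ≤ ∫ x in S, ‖h x‖ ∂μ := norm_integral_le_integral_norm _
  have havg : ‖⨍ x in S, h x ∂μ‖ = (μ.real S)⁻¹ * ‖∫ x in S, h x ∂μ‖ := by
    rw [setAverage_eq, norm_smul, Real.norm_eq_abs, abs_of_pos (inv_pos.2 hreal)]
  rw [havg, mul_pow]
  have hsq : ‖∫ x in S, h x ∂μ‖ ^ 2 ≤ (∫ x in S, ‖h x‖ ^ 2 ∂μ) * (μ S).toReal := by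
    calc ‖∫ x in S, h x ∂μ‖ ^ 2 ≤ (∫ x in S, ‖h x‖ ∂μ) ^ 2 :=
          pow_le_pow_left₀ (norm_nonneg _) hn1 2
      _ ≤ (Real.sqrt (∫ x in S, ‖h x‖ ^ 2 ∂μ) * Real.sqrt (μ S).toReal) ^ 2 :=
          pow_le_pow_left₀ (integral_nonneg fun _ => norm_nonneg _) hCS 2
      _ = (∫ x in S, ‖h x‖ ^ 2 ∂μ) * (μ S).toReal := by
          rw [mul_pow, Real.sq_sqrt hI0, Real.sq_sqrt ENNReal.toReal_nonneg]
  rw [← measureReal_def] at hsq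
  calc (μ.real S)⁻¹ ^ 2 * ‖∫ x in S, h x ∂μ‖ ^ 2
      ≤ (μ.real S)⁻¹ ^ 2 * ((∫ x in S, ‖h x‖ ^ 2 ∂μ) * μ.real S) :=
        mul_le_mul_of_nonneg_left hsq (by positivity)
    _ = (μ.real S)⁻¹ * ∫ x in S, ‖h x‖ ^ 2 ∂μ := by
        field_simp

/-- **Comparison of averages** (the Poincaré step of Tao's chaining argument, p. 33): in the
situation of `setIntegral_sq_norm_sub_setAverage_le`, for every measurable `S ⊆ A` of positive
measure, `‖⨍_S f − ⨍_B f‖² ≤ μ(S)⁻¹ 2ⁿ δ² (μ(A)/μ(B)) ∫_A ‖Df‖²`. [cite: Tao2011, §10, proof of Thm. 10.1 (p. 33, Poincaré step)] -/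
theorem sq_norm_setAverage_sub_setAverage_le {f : E → F} (hf : ContDiff ℝ 1 f) {A B S : Set E}
    (hA : IsOpen A) (hAb : Bornology.IsBounded A) (hB : MeasurableSet B) (hBA : B ⊆ A)
    (hseg : ∀ x ∈ A, ∀ y ∈ B, segment ℝ x y ⊆ A) {δ : ℝ} (hδ0 : 0 < δ)
    (hδ : ∀ x ∈ A, ∀ y ∈ B, ‖y - x‖ ≤ δ) (hB0 : μ B ≠ 0) (hSA : S ⊆ A)
    (hS0 : μ S ≠ 0) :
    ‖(⨍ x in S, f x ∂μ) - ⨍ y in B, f y ∂μ‖ ^ 2 ≤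
      (μ.real S)⁻¹ * (2 ^ Module.finrank ℝ E * δ ^ 2 * (μ.real A / μ.real B) *
        ∫ x in A, ‖fderiv ℝ f x‖ ^ 2 ∂μ) := by
  have hAt : μ A ≠ ∞ := hAb.measure_lt_top.ne
  have hSt : μ S ≠ ∞ := measure_ne_top_of_subset hSA hAt
  have hSb : Bornology.IsBounded S := hAb.subset hSA
  set c : F := ⨍ y in B, f y ∂μ with hc
  have hfc : Continuous f := hf.continuous
  have hfS : IntegrableOn f S μ := integrableOn_of_continuous_of_isBounded hfc hSb
  have hsubc : Continuous fun x => f x - c := hfc.sub continuous_const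
  -- `⨍_S f - c = ⨍_S (f - c)`
  rw [← FunctionSpaces.setAverage_sub_const hS0 hSt hfS c]
  have hJ := sq_norm_setAverage_le_inv_mul_setIntegral (μ := μ) hSt
    (h := fun x => f x - c) hsubc.aestronglyMeasurable
    (integrableOn_of_continuous_of_isBounded (hsubc.norm.pow 2) hSb)
  refine hJ.trans (mul_le_mul_of_nonneg_left ?_ (inv_nonneg.2 measureReal_nonneg))
  calc ∫ x in S, ‖f x - c‖ ^ 2 ∂μ ≤ ∫ x in A, ‖f x - c‖ ^ 2 ∂μ :=
        setIntegral_mono_set (integrableOn_of_continuous_of_isBounded (hsubc.norm.pow 2) hAb)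
          (Eventually.of_forall fun _ => sq_nonneg _) (Eventually.of_forall hSA)
    _ ≤ _ := setIntegral_sq_norm_sub_setAverage_le hf hA hAb hB hBA hseg hδ0 hδ hB0

end Poincare

end Literature.Analysis.FluidPDE.TaoY6

end
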